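import Summits.BirchSwinnertonDyer.Rank1Residual.Additive.GoodModelKernelH1OfDeeplyRamified
import Summits.BirchSwinnertonDyer.Rank1Residual.Additive.GoodModelKummerOfCoatesGreenberg
import HarnessLib

/-!
# S2 (Greenberg LNM 1716 Prop. 2.4 for a good model), A239 and the δ-input on X4♯/X3♯(G-ord)
# DERIVED from the trace form of "deeply ramified" (consumer one-liners of
# `GoodModelKernelH1OfDeeplyRamified` through `GoodModelKummerOfCoatesGreenberg`)

HONEST FRAMING (BSD rank-`≤ 1` residual cell `b2b-bsdres`, home
`run/shared/lean/b2b/bsd-rank1-residual/`, team n1011, seat n1011-p05 GEN 9, row T-CG-DR, skeleton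
`cells/n1011/skel/T-CG-DR.md`): the cell deletes the COMBINATION-SHAPED residual classes of the
rank-`≤ 1` BSD formula from PUBLISHED theorems only and TYPES the construction-shaped ones;
research route, no claim beyond the stated classes, census output = EVIDENCE, nothing booked, no
mark moves. Theorems only (one-liners, BY NAME): every consumer of the Coates–Greenberg record
`H1_goodModelKernel_trivial` (A254) filed by this lineage now has a twin fed by the field-theoretic
fact `CoatesGreenberg1996.deeplyRamified_cyclotomic_trace` (A256): S2 = A249
(`Greenberg1999.imKummer_ge_strictCondition_goodOrdinaryModel`), A239
(`Greenberg1999.imKummer_ge_strictCondition_goodOrdinary`), and the R-D identification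
`RamifiedLineKummerEqAt W p` on X4♯(G-ord) / X3♯(G-ord) (every odd `p`). X4♯/X3♯(G-ord) stay
CONSTRUCTION-SHAPED; the δ-input is re-sourced, not discharged; NOT a discharge of Tate–Sen.

References: [GreenbergLNM1716] §2 Prop. 2.4 (pp. 74–75), p. 83; [CoatesGreenberg1996] §2 p. 143,
Thm. 2.13, §3 Cor. 3.2; [IovitaZaharescu1999] Thm. 1.2.
-/

noncomputable section

open scoped Classical NNReal

open WeierstrassCurve Literature.NumberTheory.EllipticCurves
  Literature.NumberTheory.EllipticCurves.CoatesGreenberg1996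

namespace Summit.BirchSwinnertonDyer.Rank1Residual.Additive.GoodModelLine

/-! ## §1 S2 and A239 -/

/-- **S2 DERIVED from the deeply-ramified trace fact**: Greenberg LNM 1716 Prop. 2.4 for a good
model `W₀ = C • E ⊗ K̄_v` (`Greenberg1999.imKummer_ge_strictCondition_goodOrdinaryModel`, A249).
[cite: GreenbergLNM1716, §2 Prop. 2.4 (pp. 74–75) and p. 83]
[cite: CoatesGreenberg1996, §2 p. 143 / Thm. 2.13 (through IovitaZaharescu1999 Thm. 1.2) and §3 Cor. 3.2] -/
theorem imKummer_ge_strictCondition_goodOrdinaryModel_of_deeplyRamifiedTrace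
    (hDR : deeplyRamified_cyclotomic_trace.{0}) :
    Greenberg1999.imKummer_ge_strictCondition_goodOrdinaryModel :=
  imKummer_ge_strictCondition_goodOrdinaryModel_of_coatesGreenberg
    (H1_goodModelKernel_trivial_of_deeplyRamifiedTrace hDR)

/-- **A239 DERIVED from the deeply-ramified trace fact**: Greenberg's Prop. 2.4 for `E/ℚ` good
ordinary at `p` (`Greenberg1999.imKummer_ge_strictCondition_goodOrdinary`).
[cite: GreenbergLNM1716, §2 Prop. 2.4 (pp. 74–75) and p. 83]
[cite: CoatesGreenberg1996, §2 p. 143 / Thm. 2.13 (through IovitaZaharescu1999 Thm. 1.2) and §3 Cor. 3.2] -/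
theorem imKummer_ge_strictCondition_goodOrdinary_of_deeplyRamifiedTrace
    (hDR : deeplyRamified_cyclotomic_trace.{0}) :
    Greenberg1999.imKummer_ge_strictCondition_goodOrdinary :=
  imKummer_ge_strictCondition_goodOrdinary_of_coatesGreenberg
    (H1_goodModelKernel_trivial_of_deeplyRamifiedTrace hDR)

/-! ## §2 Class forms: the δ-input on X4♯(G-ord) / X3♯(G-ord) mod the deeply-ramified trace fact -/

section ClassForms

open Literature.NumberTheory.EllipticCurves.Rank1Residual
  Literature.NumberTheory.EllipticCurves.Rank1Residual.Typed

variable (W : WeierstrassCurve ℚ) [W.IsElliptic] [W.IsGloballyMinimal] (p : ℕ) [hp : Fact p.Prime]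

/-- **X4♯(G-ord), every odd `p`: the δ-input `RamifiedLineKummerEqAt W p` mod the deeply-ramified
trace fact** (`ClassX4Gord.ramifiedLineKummerEqAt_of_coatesGreenberg` fed
`H1_goodModelKernel_trivial_of_deeplyRamifiedTrace`). X4♯(G-ord) stays CONSTRUCTION-SHAPED;
nothing booked. [cite: GreenbergLNM1716, §2 Prop. 2.4 (pp. 74–75), p. 83]
[cite: CoatesGreenberg1996, §2 p. 143 / Thm. 2.13 (through IovitaZaharescu1999 Thm. 1.2) and §3 Cor. 3.2] -/
theorem ClassX4Gord.ramifiedLineKummerEqAt_of_deeplyRamifiedTrace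
    (hDR : deeplyRamified_cyclotomic_trace.{0}) (hX : ClassX4Gord W p) :
    RamifiedLineKummerEqAt W p :=
  ClassX4Gord.ramifiedLineKummerEqAt_of_coatesGreenberg W p
    (H1_goodModelKernel_trivial_of_deeplyRamifiedTrace hDR) hX

/-- **X3♯(G-ord), every odd `p`: `RamifiedLineKummerEqAt W p` mod the deeply-ramified trace fact**
(`ClassX3Gord.ramifiedLineKummerEqAt_of_coatesGreenberg`). X3♯(G-ord) stays as labelled; nothing
booked. [cite: GreenbergLNM1716, §2 Prop. 2.4 (pp. 74–75), p. 83]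
[cite: CoatesGreenberg1996, §2 p. 143 / Thm. 2.13 (through IovitaZaharescu1999 Thm. 1.2) and §3 Cor. 3.2] -/
theorem ClassX3Gord.ramifiedLineKummerEqAt_of_deeplyRamifiedTrace
    (hDR : deeplyRamified_cyclotomic_trace.{0}) (hp2 : p ≠ 2) (hX : ClassX3Gord W p) :
    RamifiedLineKummerEqAt W p :=
  ClassX3Gord.ramifiedLineKummerEqAt_of_coatesGreenberg W p
    (H1_goodModelKernel_trivial_of_deeplyRamifiedTrace hDR) hp2 hX

end ClassForms

end Summit.BirchSwinnertonDyer.Rank1Residual.Additive.GoodModelLine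

end
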